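import Summits.Langlands.Langlands.Theorems.PicardMuOrdinaryMuOrdinaryFamilyRTPointGalois
import Summits.Langlands.Langlands.Theorems.PicardMuOrdinaryMuOrdinaryFamilyRTPointFrob
import Literature.NumberTheory.GaloisRepresentations.PicardCurveGaloisRep
import Literature.RepresentationTheory.Semisimple.BurnsideMatrixSpan
import Literature.RepresentationTheory.Semisimple.SubrepresentationEquiv

/-!
# The Picard point of line `free-seed-smooth-rt` (crux `MuOrdinaryFamilyRT`, stmt-Langlands-13757):
# LEAF `rbarAbsIrreducible` — the framed heart `r̄_f^B` is absolutely irreducible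

Helper file for the registered stub `stub_point` (plan: `…PointPlan.lean`).  PROVED, unconditionally,
`theorem rbarAbsIrreducible : Leaf.rbarAbsIrreducible`: for generic `f` and every basis `B` of the heart,
`r̄_f^B : Γ_K → GL₃(𝔽₃)` is absolutely irreducible (the tree's `IsAbsIrreducible`).  Route (Burnside
over `𝔽₃` itself, no extension of scalars of modules):

* `commutant_scalar_of_kleinConfig`, `commutant_scalar_of_alternatingGroup_le` — for an
  `A₄`-configuration on `X = {a,b,c,d}` (as in the tree's `augmentationRep_isIrreducible_of_kleinConfig`)
  every `G`-endomorphism `T` of the sum-zero module `(k^X)⁰` is a SCALAR: `T` commutes with the three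
  Klein projectors `w ↦ λᵢ(w) uᵢ` (tree: `klein_proj_one/two/three`), so `T uᵢ = cᵢ uᵢ`; the `3`-cycle
  rotates `u₁ ↦ u₂ ↦ u₃` (`permRep_threeCycle_signVector`), so `c₁ = c₂ = c₃`; and `4w = Σ λᵢ(w) uᵢ`
  (`klein_decomposition`);
* `augToFrame` — the `𝔽₃[Γ_K]`-isomorphism `(𝔽₃^{roots})⁰ ≅ heart ≅ 𝔽₃³` (constants meet the sum-zero
  hyperplane trivially as `3 ∤ 4`, `augmentationConst_eq_bot`; coordinates in `B`,
  `LinearMap.toMatrix_mulVec_repr`), whence `isIrreducible_glRepresentation_rbar` (tree: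
  `augmentationRep_isIrreducible_of_alternatingGroup_le`, `isIrreducible_of_equiv`) and
  `commutant_scalar_glRepresentation_rbar`;
* `span_rbar_eq_top` — irreducible with scalar commutant ⟹ the `r̄(g)` span `M₃(𝔽₃)` (Jacobson density,
  tree `Representation.exists_asAlgebraHom_apply_eq`, the argument of the tree's
  `span_eq_top_of_isIrreducible` without algebraic closedness), and spanning is absolute
  irreducibility (`span_eq_top_iff_forall_isIrreducible`);
* the hypothesis "image of `Γ_K` on the roots `⊇ A₄`" is `alternatingGroup_le_range_toPermHom`
  (`…PointGalois.lean`).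
-/

-- `Summit.Langlands.Langlands.…` (summit = sub-problem name, D-0017 layout) trips `dupNamespace` on every decl.
set_option linter.dupNamespace false

namespace Summit.Langlands.Langlands.Cruxes.MuOrdinaryFamilyRT.FreeSeedSmoothRt

open scoped NumberField Polynomial Matrix Classical
open Field IsDedekindDomain Polynomial Finset
open Literature.NumberTheory.GaloisRepresentations Literature.RepresentationTheory.Semisimple

noncomputable section

/-! ### Scalar commutant of the augmentation module of an `A₄`-configuration over `𝔽₃` -/

section Klein

variable {k : Type*} [Field k] {G : Type*} [Group G] {X : Type*} [MulAction G X] [DecidableEq X]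

/-- **Scalar commutant of an `A₄`-configuration.**  With `X = {a, b, c, d}` and `g₁, g₂, g₃ ∈ G`
acting as `(a b)(c d)`, `(a c)(b d)`, `(b c d)`, every endomorphism of the augmentation hyperplane
`(k^X)⁰` commuting with the `G`-action is a scalar (it preserves the three Klein eigenlines
`k uᵢ`, which the `3`-cycle permutes cyclically; `4 ≠ 0` or not, `w ↦ Σ λᵢ(w) uᵢ = 4 w` decides). -/
theorem commutant_scalar_of_kleinConfig (h4 : (4 : k) ≠ 0) {a b c d : X}
    (hd : a ≠ b ∧ a ≠ c ∧ a ≠ d ∧ b ≠ c ∧ b ≠ d ∧ c ≠ d)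
    (hcov : ∀ x : X, x = a ∨ x = b ∨ x = c ∨ x = d) {g₁ g₂ g₃ : G}
    (h₁ : g₁ • a = b ∧ g₁ • b = a ∧ g₁ • c = d ∧ g₁ • d = c)
    (h₂ : g₂ • a = c ∧ g₂ • b = d ∧ g₂ • c = a ∧ g₂ • d = b)
    (h₃ : g₃ • a = a ∧ g₃ • b = c ∧ g₃ • c = d ∧ g₃ • d = b)
    (T : augmentationSubmodule k X →ₗ[k] augmentationSubmodule k X)
    (hT : ∀ g : G, T ∘ₗ augmentationRep k G X g = augmentationRep k G X g ∘ₗ T) :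
    ∃ c₀ : k, T = c₀ • LinearMap.id := by
  obtain ⟨hab, hac, had, hbc, hbd, hcd⟩ := hd
  -- the three sign vectors, in `W = (k^X)⁰`
  set u₁ : X →₀ k := Finsupp.single a (1 : k) + Finsupp.single b 1 + Finsupp.single c (-1) + Finsupp.single d (-1)
  set u₂ : X →₀ k := Finsupp.single a (1 : k) + Finsupp.single b (-1) + Finsupp.single c 1 + Finsupp.single d (-1)
  set u₃ : X →₀ k := Finsupp.single a (1 : k) + Finsupp.single b (-1) + Finsupp.single c (-1) + Finsupp.single d 1
  have hmem : ∀ s t r : k, 1 + s + t + r = 0 →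
      Finsupp.single a (1 : k) + Finsupp.single b s + Finsupp.single c t + Finsupp.single d r ∈ augmentationSubmodule k X := by
    intro s t r h
    rw [mem_augmentationSubmodule_iff]
    simp only [map_add, augmentation_single, h]
  have hu₁ : u₁ ∈ augmentationSubmodule k X := hmem 1 (-1) (-1) (by ring)
  have hu₂ : u₂ ∈ augmentationSubmodule k X := hmem (-1) 1 (-1) (by ring)
  have hu₃ : u₃ ∈ augmentationSubmodule k X := hmem (-1) (-1) 1 (by ring)
  set U₁ : augmentationSubmodule k X := ⟨u₁, hu₁⟩
  set U₂ : augmentationSubmodule k X := ⟨u₂, hu₂⟩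
  set U₃ : augmentationSubmodule k X := ⟨u₃, hu₃⟩
  -- `T` commutes with the permutation action on `W`
  have hTg : ∀ (g : G) (w : augmentationSubmodule k X),
      ((T (augmentationRep k G X g w) : augmentationSubmodule k X) : X →₀ k) = permRep k G X g (T w) := by
    intro g w
    have := LinearMap.congr_fun (hT g) w
    rw [LinearMap.comp_apply, LinearMap.comp_apply] at this
    rw [this, coe_augmentationRep_apply]
  -- coordinates of vectors of `W`
  have hsum : ∀ w : augmentationSubmodule k X, (w : X →₀ k) a + (w : X →₀ k) b + (w : X →₀ k) c + (w : X →₀ k) d = 0 :=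
    fun w => by rw [← augmentation_eq_four ⟨hab, hac, had, hbc, hbd, hcd⟩ hcov]; exact (mem_augmentationSubmodule_iff _ _).mp w.2
  -- `T` commutes with each `aug g` pointwise, in `W`
  have hTw : ∀ (g : G) (w : augmentationSubmodule k X),
      T (augmentationRep k G X g w) = augmentationRep k G X g (T w) := fun g w => by
    have := LinearMap.congr_fun (hT g) w
    rwa [LinearMap.comp_apply, LinearMap.comp_apply] at this
  -- generic eigenvector extraction from a projector identity `F w = λ(w) U`
  have eig : ∀ (F : augmentationSubmodule k X → augmentationSubmodule k X) (U : augmentationSubmodule k X)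
      (lam : augmentationSubmodule k X → k), (∀ w, F w = lam w • U) → (∀ w, T (F w) = F (T w)) →
      ∀ w, lam w • T U = lam (T w) • U := by
    intro F U lam hF hFT w
    rw [← map_smul, ← hF, hFT, hF]
  -- the three projectors
  set F₁ : augmentationSubmodule k X → augmentationSubmodule k X :=
    fun w => w + augmentationRep k G X g₁ w - augmentationRep k G X g₂ w - augmentationRep k G X (g₁ * g₂) w with hF₁
  set F₂ : augmentationSubmodule k X → augmentationSubmodule k X :=
    fun w => w - augmentationRep k G X g₁ w + augmentationRep k G X g₂ w - augmentationRep k G X (g₁ * g₂) w with hF₂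
  set F₃ : augmentationSubmodule k X → augmentationSubmodule k X :=
    fun w => w - augmentationRep k G X g₁ w - augmentationRep k G X g₂ w + augmentationRep k G X (g₁ * g₂) w with hF₃
  -- (`rw [map_sub]` does not key-match the subtraction of the submodule subtype; name the instances)
  have hTsub : ∀ p q : augmentationSubmodule k X, T (p - q) = T p - T q := fun p q => map_sub T p q
  have hTadd : ∀ p q : augmentationSubmodule k X, T (p + q) = T p + T q := fun p q => map_add T p q
  have hFT₁ : ∀ w, T (F₁ w) = F₁ (T w) := fun w => by
    change T (w + _ - _ - _) = T w + _ - _ - _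
    rw [hTsub, hTsub, hTadd, hTw, hTw, hTw]
  have hFT₂ : ∀ w, T (F₂ w) = F₂ (T w) := fun w => by
    change T (w - _ + _ - _) = T w - _ + _ - _
    rw [hTsub, hTadd, hTsub, hTw, hTw, hTw]
  have hFT₃ : ∀ w, T (F₃ w) = F₃ (T w) := fun w => by
    change T (w - _ - _ + _) = T w - _ - _ + _
    rw [hTadd, hTsub, hTsub, hTw, hTw, hTw]
  set lam₁ : augmentationSubmodule k X → k := fun w => (w : X →₀ k) a + (w : X →₀ k) b - (w : X →₀ k) c - (w : X →₀ k) d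
  set lam₂ : augmentationSubmodule k X → k := fun w => (w : X →₀ k) a - (w : X →₀ k) b + (w : X →₀ k) c - (w : X →₀ k) d
  set lam₃ : augmentationSubmodule k X → k := fun w => (w : X →₀ k) a - (w : X →₀ k) b - (w : X →₀ k) c + (w : X →₀ k) d
  have hFw₁ : ∀ w, F₁ w = lam₁ w • U₁ := fun w => Subtype.ext (by
    simp only [hF₁, AddSubgroupClass.coe_sub, Submodule.coe_add, coe_augmentationRep_apply, Submodule.coe_smul]
    exact klein_proj_one ⟨hab, hac, had, hbc, hbd, hcd⟩ hcov h₁ h₂ _)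
  have hFw₂ : ∀ w, F₂ w = lam₂ w • U₂ := fun w => Subtype.ext (by
    simp only [hF₂, AddSubgroupClass.coe_sub, Submodule.coe_add, coe_augmentationRep_apply, Submodule.coe_smul]
    exact klein_proj_two ⟨hab, hac, had, hbc, hbd, hcd⟩ hcov h₁ h₂ _)
  have hFw₃ : ∀ w, F₃ w = lam₃ w • U₃ := fun w => Subtype.ext (by
    simp only [hF₃, AddSubgroupClass.coe_sub, Submodule.coe_add, coe_augmentationRep_apply, Submodule.coe_smul]
    exact klein_proj_three ⟨hab, hac, had, hbc, hbd, hcd⟩ hcov h₁ h₂ _)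
  -- coordinates of the `uᵢ`
  have co : ∀ (s t r : k) (x : X), x = a ∨ x = b ∨ x = c ∨ x = d →
      (Finsupp.single a (1 : k) + Finsupp.single b s + Finsupp.single c t + Finsupp.single d r) x =
        if x = a then 1 else if x = b then s else if x = c then t else r := by
    intro s t r x hx
    simp only [Finsupp.coe_add, Pi.add_apply, Finsupp.single_apply]
    rcases hx with rfl | rfl | rfl | rfl <;>
      simp [hab, hab.symm, hac, hac.symm, had, had.symm, hbc, hbc.symm, hbd, hbd.symm, hcd, hcd.symm]
  have hl₁ : lam₁ U₁ = 4 := by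
    change u₁ a + u₁ b - u₁ c - u₁ d = 4
    rw [co 1 (-1) (-1) a (Or.inl rfl), co 1 (-1) (-1) b (Or.inr (Or.inl rfl)), co 1 (-1) (-1) c (Or.inr (Or.inr (Or.inl rfl))),
      co 1 (-1) (-1) d (Or.inr (Or.inr (Or.inr rfl)))]
    simp only [if_true, if_neg hab.symm, if_neg hac.symm, if_neg hbc.symm, if_neg had.symm, if_neg hbd.symm, if_neg hcd.symm]
    ring
  have hl₂ : lam₂ U₂ = 4 := by
    change u₂ a - u₂ b + u₂ c - u₂ d = 4
    rw [co (-1) 1 (-1) a (Or.inl rfl), co (-1) 1 (-1) b (Or.inr (Or.inl rfl)), co (-1) 1 (-1) c (Or.inr (Or.inr (Or.inl rfl))),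
      co (-1) 1 (-1) d (Or.inr (Or.inr (Or.inr rfl)))]
    simp only [if_true, if_neg hab.symm, if_neg hac.symm, if_neg hbc.symm, if_neg had.symm, if_neg hbd.symm, if_neg hcd.symm]
    ring
  have hl₃ : lam₃ U₃ = 4 := by
    change u₃ a - u₃ b - u₃ c + u₃ d = 4
    rw [co (-1) (-1) 1 a (Or.inl rfl), co (-1) (-1) 1 b (Or.inr (Or.inl rfl)), co (-1) (-1) 1 c (Or.inr (Or.inr (Or.inl rfl))),
      co (-1) (-1) 1 d (Or.inr (Or.inr (Or.inr rfl)))]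
    simp only [if_true, if_neg hab.symm, if_neg hac.symm, if_neg hbc.symm, if_neg had.symm, if_neg hbd.symm, if_neg hcd.symm]
    ring
  -- `T Uᵢ = cᵢ Uᵢ`
  have hsc : ∀ (P : augmentationSubmodule k X → augmentationSubmodule k X) (U : augmentationSubmodule k X)
      (lam : augmentationSubmodule k X → k), (∀ w, P w = lam w • U) → (∀ w, T (P w) = P (T w)) → lam U = 4 →
      T U = ((4 : k)⁻¹ * lam (T U)) • U := by
    intro P U lam hP hPT hU
    have h := eig P U lam hP hPT U
    rw [hU] at h
    rw [mul_smul, ← h, smul_smul, inv_mul_cancel₀ h4, one_smul]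
  have hT₁ := hsc F₁ U₁ lam₁ hFw₁ hFT₁ hl₁
  have hT₂ := hsc F₂ U₂ lam₂ hFw₂ hFT₂ hl₂
  have hT₃ := hsc F₃ U₃ lam₃ hFw₃ hFT₃ hl₃
  set c₁ := (4 : k)⁻¹ * lam₁ (T U₁)
  set c₂ := (4 : k)⁻¹ * lam₂ (T U₂)
  set c₃ := (4 : k)⁻¹ * lam₃ (T U₃)
  -- the `3`-cycle rotates `U₁ ↦ U₂ ↦ U₃`, so `c₁ = c₂ = c₃`
  have hg₃₁ : augmentationRep k G X g₃ U₁ = U₂ :=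
    Subtype.ext (by rw [coe_augmentationRep_apply]; exact permRep_threeCycle_signVector h₃ 1 (-1) (-1))
  have hg₃₂ : augmentationRep k G X g₃ U₂ = U₃ :=
    Subtype.ext (by rw [coe_augmentationRep_apply]; exact permRep_threeCycle_signVector h₃ (-1) 1 (-1))
  have hUa : ∀ U : augmentationSubmodule k X, (U : X →₀ k) a = 1 → ∀ x y : k, x • U = y • U → x = y := by
    intro U hU x y hxy
    have := congrArg (fun v : augmentationSubmodule k X => (v : X →₀ k) a) hxy
    simp only [Submodule.coe_smul, Finsupp.coe_smul, Pi.smul_apply, smul_eq_mul, hU, mul_one] at this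
    exact this
  have hU₂a : (U₂ : X →₀ k) a = 1 := by
    change u₂ a = 1
    rw [co (-1) 1 (-1) a (Or.inl rfl), if_pos rfl]
  have hU₃a : (U₃ : X →₀ k) a = 1 := by
    change u₃ a = 1
    rw [co (-1) (-1) 1 a (Or.inl rfl), if_pos rfl]
  have h12 : c₁ = c₂ := by
    refine hUa U₂ hU₂a c₁ c₂ ?_
    rw [← hT₂, ← hg₃₁, hTw, hT₁, map_smul]
  have h23 : c₂ = c₃ := by
    refine hUa U₃ hU₃a c₂ c₃ ?_
    rw [← hT₃, ← hg₃₂, hTw, hT₂, map_smul]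
  -- conclude with the Klein decomposition `4 w = Σ λᵢ(w) Uᵢ`
  refine ⟨c₁, LinearMap.ext fun w => ?_⟩
  have hdec : (4 : k) • w = lam₁ w • U₁ + lam₂ w • U₂ + lam₃ w • U₃ := Subtype.ext (by
    simp only [Submodule.coe_smul, Submodule.coe_add]
    exact klein_decomposition ⟨hab, hac, had, hbc, hbd, hcd⟩ hcov (hsum w))
  have h4w : (4 : k) • T w = (4 : k) • (c₁ • w) := by
    rw [← map_smul, hdec, map_add, map_add, map_smul, map_smul, map_smul, hT₁, hT₂, hT₃, ← h23, ← h12,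
      smul_comm (4 : k) c₁ w, hdec]
    simp only [smul_add, smul_smul, mul_comm]
  rw [LinearMap.smul_apply, LinearMap.id_apply]
  exact smul_right_injective _ h4 h4w

/-- **Scalar commutant once the image contains `A₄`** (`#X = 4`, `4 ≠ 0` in `k`): every
`G`-endomorphism of `(k^X)⁰` is a scalar. -/
theorem commutant_scalar_of_alternatingGroup_le (h4 : (4 : k) ≠ 0) [Fintype X] (hX : Fintype.card X = 4)
    (hA : alternatingGroup X ≤ (MulAction.toPermHom G X).range)
    (T : augmentationSubmodule k X →ₗ[k] augmentationSubmodule k X)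
    (hT : ∀ g : G, T ∘ₗ augmentationRep k G X g = augmentationRep k G X g ∘ₗ T) :
    ∃ c₀ : k, T = c₀ • LinearMap.id := by
  obtain ⟨e⟩ : Nonempty (X ≃ Fin 4) := ⟨Fintype.equivFinOfCardEq hX⟩
  set a := e.symm 0 with ha
  set b := e.symm 1 with hb
  set c := e.symm 2 with hc
  set d := e.symm 3 with hd'
  have hab : a ≠ b := e.symm.injective.ne (by decide)
  have hac : a ≠ c := e.symm.injective.ne (by decide)
  have had : a ≠ d := e.symm.injective.ne (by decide)
  have hbc : b ≠ c := e.symm.injective.ne (by decide)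
  have hbd : b ≠ d := e.symm.injective.ne (by decide)
  have hcd : c ≠ d := e.symm.injective.ne (by decide)
  have hcov : ∀ x : X, x = a ∨ x = b ∨ x = c ∨ x = d := by
    intro x
    obtain ⟨i, rfl⟩ := e.symm.surjective x
    fin_cases i
    · exact Or.inl rfl
    · exact Or.inr (Or.inl rfl)
    · exact Or.inr (Or.inr (Or.inl rfl))
    · exact Or.inr (Or.inr (Or.inr rfl))
  have hsign : ∀ {x y z w : X}, x ≠ y → z ≠ w → Equiv.swap x y * Equiv.swap z w ∈ alternatingGroup X := by
    intro x y z w hxy hzw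
    rw [Equiv.Perm.mem_alternatingGroup, Equiv.Perm.sign_mul, Equiv.Perm.sign_swap hxy, Equiv.Perm.sign_swap hzw]
    decide
  have lift : ∀ σ ∈ alternatingGroup X, ∃ g : G, ∀ x : X, g • x = σ x := by
    intro σ hσ
    obtain ⟨g, hg⟩ := hA hσ
    exact ⟨g, fun x => by rw [← MulAction.toPerm_apply, ← MulAction.toPermHom_apply, hg]⟩
  obtain ⟨g₁, hg₁⟩ := lift _ (hsign hab hcd)
  obtain ⟨g₂, hg₂⟩ := lift _ (hsign hac hbd)
  obtain ⟨g₃, hg₃⟩ := lift _ (hsign hbc hcd)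
  refine commutant_scalar_of_kleinConfig h4 ⟨hab, hac, had, hbc, hbd, hcd⟩ hcov
    (g₁ := g₁) (g₂ := g₂) (g₃ := g₃) ⟨?_, ?_, ?_, ?_⟩ ⟨?_, ?_, ?_, ?_⟩ ⟨?_, ?_, ?_, ?_⟩ T hT
  · rw [hg₁, Equiv.Perm.mul_apply, Equiv.swap_apply_of_ne_of_ne hac had, Equiv.swap_apply_left]
  · rw [hg₁, Equiv.Perm.mul_apply, Equiv.swap_apply_of_ne_of_ne hbc hbd, Equiv.swap_apply_right]
  · rw [hg₁, Equiv.Perm.mul_apply, Equiv.swap_apply_left, Equiv.swap_apply_of_ne_of_ne had.symm hbd.symm]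
  · rw [hg₁, Equiv.Perm.mul_apply, Equiv.swap_apply_right, Equiv.swap_apply_of_ne_of_ne hac.symm hbc.symm]
  · rw [hg₂, Equiv.Perm.mul_apply, Equiv.swap_apply_of_ne_of_ne hab had, Equiv.swap_apply_left]
  · rw [hg₂, Equiv.Perm.mul_apply, Equiv.swap_apply_left, Equiv.swap_apply_of_ne_of_ne had.symm hcd.symm]
  · rw [hg₂, Equiv.Perm.mul_apply, Equiv.swap_apply_of_ne_of_ne hbc.symm hcd, Equiv.swap_apply_right]
  · rw [hg₂, Equiv.Perm.mul_apply, Equiv.swap_apply_right, Equiv.swap_apply_of_ne_of_ne hab.symm hbc]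
  · rw [hg₃, Equiv.Perm.mul_apply, Equiv.swap_apply_of_ne_of_ne hac had, Equiv.swap_apply_of_ne_of_ne hab hac]
  · rw [hg₃, Equiv.Perm.mul_apply, Equiv.swap_apply_of_ne_of_ne hbc hbd, Equiv.swap_apply_left]
  · rw [hg₃, Equiv.Perm.mul_apply, Equiv.swap_apply_left, Equiv.swap_apply_of_ne_of_ne hbd.symm hcd.symm]
  · rw [hg₃, Equiv.Perm.mul_apply, Equiv.swap_apply_right, Equiv.swap_apply_right]

end Klein

/-! ### From the augmentation module to the framed heart `rbar f B` -/

section Transfer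

variable (f : ℤ[X]) (hgen : Generic f) (B : Module.Basis (Fin 3) (ZMod 3) (Heart 3 (Roots f)))

include hgen in
/-- `3 ∤ 4 = #Roots f`. -/
theorem not_three_dvd_card_roots : ¬ 3 ∣ Fintype.card (Roots f) := by
  rw [card_roots hgen]; decide

/-- The matrix of `r̄_f^B(g)` is the matrix of the heart in the basis `B`. -/
theorem rbar_val (g : absoluteGaloisGroup K) :
    (rbar f B g).val = LinearMap.toMatrix B B (heartRep 3 (Roots f) (absoluteGaloisGroup K) g) := rfl

/-- The `𝔽₃[Γ_K]`-isomorphism `(𝔽₃^{roots})⁰ ≅ 𝔽₃³` (heart `=` sum-zero module as `3 ∤ 4`; coordinates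
in `B`) intertwining the augmentation representation and the matrix representation `r̄_f^B`. -/
def augToFrame : augmentationSubmodule (ZMod 3) (Roots f) ≃ₗ[ZMod 3] (Fin 3 → ZMod 3) :=
  (Submodule.quotEquivOfEqBot _ (augmentationConst_eq_bot 3 (Roots f) (not_three_dvd_card_roots f hgen))).symm.trans
    B.equivFun

/-- Equivariance of `augToFrame`. -/
theorem augToFrame_comp (g : absoluteGaloisGroup K) :
    (augToFrame f hgen B).toLinearMap ∘ₗ augmentationRep (ZMod 3) (absoluteGaloisGroup K) (Roots f) g =
      glRepresentation (rbar f B) g ∘ₗ (augToFrame f hgen B).toLinearMap := by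
  refine LinearMap.ext fun w => ?_
  rw [LinearMap.comp_apply, LinearMap.comp_apply, LinearEquiv.coe_coe, augToFrame, LinearEquiv.trans_apply,
    LinearEquiv.trans_apply, Submodule.quotEquivOfEqBot_symm_apply, Submodule.quotEquivOfEqBot_symm_apply,
    glRepresentation_apply_apply, rbar_val, Module.Basis.equivFun_apply, Module.Basis.equivFun_apply,
    LinearMap.toMatrix_mulVec_repr, ← heartRep_mk]

include hgen in
/-- **The framed heart is irreducible over `𝔽₃`** for generic `f` whose Galois image on the roots
contains `A₄` (tree: `augmentationRep_isIrreducible_of_alternatingGroup_le`). -/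
theorem isIrreducible_glRepresentation_rbar
    (hA : alternatingGroup (Roots f) ≤ (MulAction.toPermHom (absoluteGaloisGroup K) (Roots f)).range) :
    (glRepresentation (rbar f B)).IsIrreducible := by
  haveI := augmentationRep_isIrreducible_of_alternatingGroup_le (k := ZMod 3) (G := absoluteGaloisGroup K)
    (X := Roots f) (by decide) (card_roots hgen) hA
  exact Representation.isIrreducible_of_equiv (Representation.Equiv.mk (augToFrame f hgen B) (augToFrame_comp f hgen B))

include hgen in
/-- **The framed heart has scalar commutant over `𝔽₃`** (under the same hypothesis). -/
theorem commutant_scalar_glRepresentation_rbar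
    (hA : alternatingGroup (Roots f) ≤ (MulAction.toPermHom (absoluteGaloisGroup K) (Roots f)).range)
    (T : (Fin 3 → ZMod 3) →ₗ[ZMod 3] (Fin 3 → ZMod 3))
    (hT : ∀ g, T ∘ₗ glRepresentation (rbar f B) g = glRepresentation (rbar f B) g ∘ₗ T) :
    ∃ c : ZMod 3, T = c • LinearMap.id := by
  set E := augToFrame f hgen B with hE
  set T' : augmentationSubmodule (ZMod 3) (Roots f) →ₗ[ZMod 3] augmentationSubmodule (ZMod 3) (Roots f) :=
    E.symm.toLinearMap ∘ₗ T ∘ₗ E.toLinearMap with hT'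
  have hcomm := augToFrame_comp f hgen B
  have hT'g : ∀ g, T' ∘ₗ augmentationRep (ZMod 3) (absoluteGaloisGroup K) (Roots f) g =
      augmentationRep (ZMod 3) (absoluteGaloisGroup K) (Roots f) g ∘ₗ T' := by
    intro g
    have h1 : E.toLinearMap ∘ₗ augmentationRep (ZMod 3) (absoluteGaloisGroup K) (Roots f) g =
        glRepresentation (rbar f B) g ∘ₗ E.toLinearMap := hcomm g
    have h2 : augmentationRep (ZMod 3) (absoluteGaloisGroup K) (Roots f) g ∘ₗ E.symm.toLinearMap =
        E.symm.toLinearMap ∘ₗ glRepresentation (rbar f B) g := by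
      refine LinearMap.ext fun v => ?_
      apply E.injective
      have := LinearMap.congr_fun h1 (E.symm v)
      simp only [LinearMap.comp_apply, LinearEquiv.coe_coe, LinearEquiv.apply_symm_apply] at this ⊢
      exact this
    refine LinearMap.ext fun w => ?_
    have e1 := LinearMap.congr_fun h1 w
    have e3 := LinearMap.congr_fun (hT g) (E w)
    simp only [LinearMap.comp_apply, LinearEquiv.coe_coe] at e1 e3
    have e2 := LinearMap.congr_fun h2 (T (E w))
    simp only [LinearMap.comp_apply, LinearEquiv.coe_coe] at e2
    simp only [hT', LinearMap.comp_apply, LinearEquiv.coe_coe]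
    rw [e1, e3, e2]
  obtain ⟨c, hc⟩ := commutant_scalar_of_alternatingGroup_le (k := ZMod 3) (by decide) (card_roots hgen) hA T' hT'g
  refine ⟨c, LinearMap.ext fun v => ?_⟩
  have := LinearMap.congr_fun hc (E.symm v)
  simp only [hT', LinearMap.comp_apply, LinearEquiv.coe_coe, LinearEquiv.apply_symm_apply, LinearMap.smul_apply,
    LinearMap.id_apply] at this
  have := congrArg E this
  rw [LinearEquiv.apply_symm_apply, map_smul, LinearEquiv.apply_symm_apply] at this
  rw [this, LinearMap.smul_apply, LinearMap.id_apply]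

include hgen in
/-- **Burnside over `𝔽₃`**: the matrices `r̄_f^B(g)` span `M₃(𝔽₃)` (irreducible with scalar
commutant ⟹ Jacobson density). -/
theorem span_rbar_eq_top
    (hA : alternatingGroup (Roots f) ≤ (MulAction.toPermHom (absoluteGaloisGroup K) (Roots f)).range) :
    Submodule.span (ZMod 3) (Set.range fun g => (rbar f B g).val) = ⊤ := by
  set R : Representation (ZMod 3) (absoluteGaloisGroup K) (Fin 3 → ZMod 3) := glRepresentation (rbar f B) with hR
  haveI : R.IsIrreducible := isIrreducible_glRepresentation_rbar f hgen B hA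
  have hRlin : ∀ g, R g = Matrix.toLin' (rbar f B g).val := fun g =>
    LinearMap.ext fun v => by rw [Matrix.toLin'_apply]; rfl
  have hs := commutant_scalar_glRepresentation_rbar f hgen B hA
  rw [eq_top_iff]
  rintro M -
  obtain ⟨r, hr⟩ := Representation.exists_asAlgebraHom_apply_eq (ρ := R) hs
    (Finset.univ.image fun i : Fin 3 => (Pi.single i 1 : Fin 3 → ZMod 3)) (Matrix.toLin' M)
  have hrM : R.asAlgebraHom r = Matrix.toLin' M := by
    refine (Pi.basisFun (ZMod 3) (Fin 3)).ext fun i => ?_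
    rw [Pi.basisFun_apply]
    exact hr _ (Finset.mem_image.mpr ⟨i, Finset.mem_univ _, rfl⟩)
  have hmem : R.asAlgebraHom r ∈ Submodule.span (ZMod 3) (Set.range fun g => (R g : (Fin 3 → ZMod 3) →ₗ[ZMod 3] _)) := by
    rw [Representation.asAlgebraHom_def, MonoidAlgebra.lift_apply, Finsupp.sum]
    exact Submodule.sum_mem _ fun g _ => Submodule.smul_mem _ _ (Submodule.subset_span ⟨g, rfl⟩)
  have himage := Submodule.mem_map_of_mem
    (f := (LinearMap.toMatrix' : ((Fin 3 → ZMod 3) →ₗ[ZMod 3] (Fin 3 → ZMod 3)) ≃ₗ[ZMod 3]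
      Matrix (Fin 3) (Fin 3) (ZMod 3)).toLinearMap) hmem
  rw [hrM, Submodule.map_span, ← Set.range_comp] at himage
  have hM : (LinearMap.toMatrix' : ((Fin 3 → ZMod 3) →ₗ[ZMod 3] (Fin 3 → ZMod 3)) ≃ₗ[ZMod 3] _).toLinearMap
      (Matrix.toLin' M) = M := LinearMap.toMatrix'_toLin' M
  rw [hM] at himage
  have hcomp : ((LinearMap.toMatrix' : ((Fin 3 → ZMod 3) →ₗ[ZMod 3] (Fin 3 → ZMod 3)) ≃ₗ[ZMod 3] _).toLinearMap ∘
      fun g => (R g : (Fin 3 → ZMod 3) →ₗ[ZMod 3] _)) = fun g => (rbar f B g).val := by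
    funext g
    simp only [Function.comp_apply, LinearEquiv.coe_coe, hRlin, LinearMap.toMatrix'_toLin']
  rw [hcomp] at himage
  exact himage

include hgen in
/-- **Absolute irreducibility of the framed heart**, granted that the Galois image on the four roots
contains `A₄`. -/
theorem isAbsIrreducible_rbar_of_alternatingGroup_le
    (hA : alternatingGroup (Roots f) ≤ (MulAction.toPermHom (absoluteGaloisGroup K) (Roots f)).range) :
    IsAbsIrreducible (rbar f B) :=
  (Literature.RepresentationTheory.Semisimple.span_eq_top_iff_forall_isIrreducible (by norm_num : 0 < 3) (rbar f B)).mp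
    (span_rbar_eq_top f hgen B hA)

end Transfer

/-- **LEAF `rbarAbsIrreducible`** (registered helper goal of `stub_point`): for generic `f` the framed
heart `r̄_f^B` is absolutely irreducible. -/
theorem rbarAbsIrreducible : Leaf.rbarAbsIrreducible :=
  fun f B hgen => isAbsIrreducible_rbar_of_alternatingGroup_le f hgen B (alternatingGroup_le_range_toPermHom hgen)

end

end Summit.Langlands.Langlands.Cruxes.MuOrdinaryFamilyRT.FreeSeedSmoothRt
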